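import Summits.ResolutionOfSingularities.ResolutionOfSingularities.Theses.FrobeniusLadder
import Summits.ResolutionOfSingularities.ResolutionOfSingularities.Theorems.FrobeniusLadderFRationalResolutionSuspensionLocalClause
import Summits.ResolutionOfSingularities.ResolutionOfSingularities.Theorems.FrobeniusLadderFRationalResolutionSpecHypersurface
import Summits.ResolutionOfSingularities.ResolutionOfSingularities.Theorems.FrobeniusLadderFRationalResolutionSuspensionNotRegular
import HarnessLib

/-!
# Suspension calibration, III: `FRationalResolution` must resolve every hyperbolic suspension

Support file for crux stmt-ResolutionOfSingularities-15317 (`FrobeniusLadder.FRationalResolution`),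
line `Sketch`, continuation seat c2. The calibration note
`Cruxes/FRationalResolution/NEGATIVE-suspension-calibration.md` as THEOREMS, for every field `k` of
characteristic `p`:

* `suspension_package` — `Σf = Spec k[y,z,x₁..xₙ]/(yz + f)` (`f ≠ 0`) is separated, of finite
  type, quasi-compact and reduced over `k`, and EVERY stalk is a domain with EVERY ideal tightly
  closed; in particular `Σf` with the identity as model satisfies the hypothesis of the crux
  (`suspension_localClause` + the Spec glue `stub_specHypersurface`);
* `fRationalResolution_resolves_suspension` — hence the crux implies `HasResolution Σf` for all `f`;
* `suspension_not_isRegular` — `Σf` is NOT regular as soon as `f ∈ (x₁..xₙ)²`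
  (`stub_suspension_not_regular` at the origin, moved to the stalk by the glue);
* `fRationalResolution_resolves_singular_suspension` — headline: the residual class of rank 4 of route
  `FrobeniusLadder` contains, as a SINGULAR weakly-F-regular `(n+1)`-fold, the suspension of every
  hypersurface singularity `f = 0` through the origin of `𝔸ⁿ` (two dimensions down), so the route
  header's "why-easier" for rank 4 (the class excludes the catalogued specimens) holds only pointwise:
  the specimens re-enter as singular loci `Sing V(f) × {y = z = 0}`.

References: calibration note (Claims A, B); Glassbrenner 1996; Hochster–Huneke 1989/1994; Kollár 2007
Ex. 3.6.2 (`uv = z²t²`).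
-/

-- single-problem summit: the doubled namespace component `ResolutionOfSingularities` is forced
set_option linter.dupNamespace false

noncomputable section

open CategoryTheory AlgebraicGeometry TopologicalSpace
open Literature.AlgebraicGeometry.Resolution Literature.RingTheory.TightClosure

namespace Summit.ResolutionOfSingularities.ResolutionOfSingularities.Theorems.FRationalResolution

section SchemeLevel

open MvPolynomial
open Summit.ResolutionOfSingularities.ResolutionOfSingularities.Theses.FrobeniusLadder (FRationalResolution)

/-- **The hyperbolic suspension satisfies the hypothesis of the crux** (with the identity as its
F-rational model). For every prime `p`, every field `k` of characteristic `p`, every `n` and every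
non-zero `f ∈ k[x₁..xₙ]`, the affine `k`-scheme `Σf = Spec k[y,z,x₁..xₙ]/(yz + f)` is separated, of
finite type, quasi-compact and reduced over `k`, and EVERY stalk of `Σf` is a domain in which EVERY
ideal is tightly closed (inline form) — in particular every ideal generated by a system of
parameters, which is the crux's clause. (`stub_specHypersurface` over `suspension_localClause`.) -/
theorem suspension_package (k : Type) [Field k] (n : ℕ) (f : MvPolynomial (Fin n) k) (p : ℕ)
    [Fact p.Prime] [CharP k p] (hf : f ≠ 0) :
    let R := MvPolynomial (Fin 2 ⊕ Fin n) k ⧸ Ideal.span {(MvPolynomial.X (Sum.inl 0) *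
      MvPolynomial.X (Sum.inl 1) + MvPolynomial.rename Sum.inr f : MvPolynomial (Fin 2 ⊕ Fin n) k)}
    let X := Spec (CommRingCat.of R)
    let φ : X ⟶ Spec (CommRingCat.of k) := Spec.map (CommRingCat.ofHom (algebraMap k R))
    IsSeparated φ ∧ LocallyOfFiniteType φ ∧ QuasiCompact φ ∧ IsReduced X ∧
    (∀ x : X, IsDomain (X.presheaf.stalk x) ∧
      ∀ (I : Ideal (X.presheaf.stalk x)) (y c : X.presheaf.stalk x), c ≠ 0 →
        (∀ e : ℕ, c * y ^ p ^ e ∈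
          Ideal.span ((fun z : X.presheaf.stalk x => z ^ p ^ e) '' (I : Set (X.presheaf.stalk x)))) →
        y ∈ I) ∧
    (∀ (P : Ideal (MvPolynomial (Fin 2 ⊕ Fin n) k)) [P.IsPrime],
      (MvPolynomial.X (Sum.inl 0) * MvPolynomial.X (Sum.inl 1) + MvPolynomial.rename Sum.inr f :
        MvPolynomial (Fin 2 ⊕ Fin n) k) ∈ P → ∃ x : X,
      Nonempty (X.presheaf.stalk x ≃+* Localization.AtPrime P ⧸ Ideal.span {algebraMap
        (MvPolynomial (Fin 2 ⊕ Fin n) k) (Localization.AtPrime P)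
        (MvPolynomial.X (Sum.inl 0) * MvPolynomial.X (Sum.inl 1) + MvPolynomial.rename Sum.inr f)})) :=
  stub_specHypersurface p k _ _ fun P _ hP => suspension_localClause k n p f hf P hP

/-- **`FRationalResolution` must resolve every hyperbolic suspension.** If the crux holds then for
every prime `p`, every field `k` of characteristic `p` and every non-zero `f ∈ k[x₁..xₙ]` the
hypersurface `Σf = Spec k[y,z,x]/(yz + f)` — whose singular locus is `Sing V(f) × {y = z = 0}`, i.e.
an ARBITRARY hypersurface singularity two dimensions down — has a resolution of singularities: take
`X = X' = Σf`, `π = 𝟙` in the crux (`suspension_package`). This is the calibration note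
`NEGATIVE-suspension-calibration.md` (Claim A, every field `k`) as a theorem. -/
theorem fRationalResolution_resolves_suspension (k : Type) [Field k] (n : ℕ)
    (f : MvPolynomial (Fin n) k) (p : ℕ) [Fact p.Prime] [CharP k p] (h : FRationalResolution)
    (hf : f ≠ 0) :
    Scheme.HasResolution (Spec (CommRingCat.of (MvPolynomial (Fin 2 ⊕ Fin n) k ⧸ Ideal.span
      {(MvPolynomial.X (Sum.inl 0) * MvPolynomial.X (Sum.inl 1) + MvPolynomial.rename Sum.inr f :
        MvPolynomial (Fin 2 ⊕ Fin n) k)}))) := by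
  have hp := (Fact.out : p.Prime)
  obtain ⟨hsep, hft, hqc, hred, hst, -⟩ := suspension_package k n f p hf
  refine h p hp k (Spec (CommRingCat.of ((MvPolynomial (Fin 2 ⊕ Fin n) k) ⧸ Ideal.span {(MvPolynomial.X (Sum.inl 0) * MvPolynomial.X (Sum.inl 1) +
      MvPolynomial.rename Sum.inr f : MvPolynomial (Fin 2 ⊕ Fin n) k)}))) _ hsep hft hqc hred
    ⟨Spec (CommRingCat.of ((MvPolynomial (Fin 2 ⊕ Fin n) k) ⧸ Ideal.span {(MvPolynomial.X (Sum.inl 0) * MvPolynomial.X (Sum.inl 1) +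
      MvPolynomial.rename Sum.inr f : MvPolynomial (Fin 2 ⊕ Fin n) k)})), 𝟙 _, inferInstance, ⟨⊤, ?_, ?_, ?_⟩, fun x => ?_⟩
  · simp
  · simp
  · infer_instance
  · exact ⟨(hst x).1, fun d _ s _ y c hc hy => (hst x).2 _ y c hc hy⟩

/-- **The suspension is singular whenever `f ∈ (x)²`**: for `f ≠ 0` in `(x₁..xₙ)²`, the scheme
`Σf = Spec k[y,z,x]/(yz + f)` is NOT regular (its local ring at the origin is `S_𝔪/(g)` with
`0 ≠ g ∈ 𝔪²`, `stub_suspension_not_regular`, transported to the stalk by `suspension_package`). So the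
residual class of the crux contains, for every hypersurface singularity `f = 0` through the origin of
`𝔸ⁿ`, a singular F-rational (indeed weakly F-regular) `(n+1)`-fold. -/
theorem suspension_not_isRegular (k : Type) [Field k] (n : ℕ) (f : MvPolynomial (Fin n) k) (p : ℕ)
    [Fact p.Prime] [CharP k p] (hf0 : f ≠ 0)
    (hf2 : f ∈ (Ideal.span (Set.range MvPolynomial.X) : Ideal (MvPolynomial (Fin n) k)) ^ 2) :
    ¬ Scheme.IsRegular (Spec (CommRingCat.of (MvPolynomial (Fin 2 ⊕ Fin n) k ⧸ Ideal.span
      {(MvPolynomial.X (Sum.inl 0) * MvPolynomial.X (Sum.inl 1) + MvPolynomial.rename Sum.inr f :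
        MvPolynomial (Fin 2 ⊕ Fin n) k)}))) := by
  intro hreg
  obtain ⟨hmax, hM⟩ := stub_suspension_not_regular k n f hf0 hf2
  haveI := hmax
  obtain ⟨hgM, hnreg⟩ := hM (Ideal.span (Set.range X)) rfl
  obtain ⟨-, -, -, -, -, hiso⟩ := suspension_package k n f p hf0
  obtain ⟨x, ⟨iso⟩⟩ := hiso (Ideal.span (Set.range X)) hgM
  haveI : IsRegularLocalRing ((Spec (CommRingCat.of ((MvPolynomial (Fin 2 ⊕ Fin n) k) ⧸ Ideal.span {(MvPolynomial.X (Sum.inl 0) * MvPolynomial.X (Sum.inl 1) +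
      MvPolynomial.rename Sum.inr f : MvPolynomial (Fin 2 ⊕ Fin n) k)}))).presheaf.stalk x) := hreg x
  exact hnreg (IsRegularLocalRing.of_ringEquiv iso)

/-- **Calibration, headline form.** Under `FRationalResolution`: for every prime `p`, field `k` of
characteristic `p`, and `0 ≠ f ∈ (x₁..xₙ)² ⊂ k[x₁..xₙ]`, the SINGULAR F-rational `k`-variety
`Σf = {yz + f = 0} ⊂ 𝔸ⁿ⁺²` has a resolution of singularities. The crux's residual class is therefore
not a "small" class: resolving it resolves, inside singular loci, all hypersurface singularities of
dimension `n − 1`, for every `n`. -/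
theorem fRationalResolution_resolves_singular_suspension (k : Type) [Field k] (n : ℕ)
    (f : MvPolynomial (Fin n) k) (p : ℕ) [Fact p.Prime] [CharP k p] (h : FRationalResolution)
    (hf0 : f ≠ 0) (hf2 : f ∈ (Ideal.span (Set.range MvPolynomial.X) : Ideal (MvPolynomial (Fin n) k)) ^ 2) :
    ¬ Scheme.IsRegular (Spec (CommRingCat.of (MvPolynomial (Fin 2 ⊕ Fin n) k ⧸ Ideal.span
      {(MvPolynomial.X (Sum.inl 0) * MvPolynomial.X (Sum.inl 1) + MvPolynomial.rename Sum.inr f :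
        MvPolynomial (Fin 2 ⊕ Fin n) k)}))) ∧
    Scheme.HasResolution (Spec (CommRingCat.of (MvPolynomial (Fin 2 ⊕ Fin n) k ⧸ Ideal.span
      {(MvPolynomial.X (Sum.inl 0) * MvPolynomial.X (Sum.inl 1) + MvPolynomial.rename Sum.inr f :
        MvPolynomial (Fin 2 ⊕ Fin n) k)}))) :=
  ⟨suspension_not_isRegular k n f p hf0 hf2, fRationalResolution_resolves_suspension k n f p h hf0⟩

end SchemeLevel

end Summit.ResolutionOfSingularities.ResolutionOfSingularities.Theorems.FRationalResolution

end
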